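import Summits.ResolutionOfSingularities.ResolutionOfSingularities.Theorems.EquisingularLiftEquisingularLiftNatSpecimenCayleyRuledAlgebra
import HarnessLib

/-!
# [OURS · L1 W4.5(b) · EL♮(3)] NOSE ENGINE CERTIFICATION ‖ K, specimen 4 — the NODAL CUBIC CONE `(x₀ + x₁)x₂x₃ + x₂³ + x₃³`: the polynomial algebra
# (chart equations, strict-transform charts by COMBINATION derivations, smooth charts, primes; every field, every characteristic)

Cell `res-hironaka`, slot W4.5(b); crux **EL♮(3)** (stmt-ResolutionOfSingularities-20148); width seat res-L1-w45b-nose-w3, row «NOSE ENGINE CERT ‖ K» of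
res-L1-w45b-plan-1's WIDTH TABLE D1′. `--supports stmt-ResolutionOfSingularities-20148 --as helper`; closes nothing. OURS; NOT a statement of any
manuscript; AI-written, weaker than expert review. Five small `def`s (chart equations), no `sorry`, standard axioms. No local instances.

The specimen: `H = V₊((x₀ + x₁)x₂x₃ + x₂³ + x₃³) ⊂ ℙ³_k` — the CONE over the NODAL plane cubic `zuv + u³ + v³` (node at `u = v = 0`), with vertex `[1:−1:0:0]`
placed OFF the coordinate points so that no chart equation is a `y₀`-free cylinder (which would need the irreducibility of the nodal cubic as a plane curve);
singular along the double line `Σ = V(x₂, x₃)` (transversal type `A₁`, a triple point at the vertex). The fourth and last projective type of integral cubic surface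
with one-dimensional singular locus (two cones over the singular plane cubics, two scrolls — R2, `CayleyRuled`, `CuspCone` are the other three). Chart equations:
`g = (y₀ + 1)y₁y₂ + y₁³ + y₂³` on BOTH `D₊(x₀)` and `D₊(x₁)` (centre `(y₁, y₂)`), `g₂ = (y₀ + y₁)y₂ + 1 + y₂³`, `g₃ = (y₀ + y₁)y₂ + y₂³ + 1` (centre `(1)`).

* the strict-transform charts `isRegularRing_chart₁/₂` (`b = y₁`: `(y₀+1)y₂ + y₁ + y₁y₂³`; `b = y₂`: `(y₀+1)y₁ + y₂y₁³ + y₂`) — regular by the COMBINATION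
  derivations `∂₁ − y₂²∂₀` resp. `∂₂ − y₁²∂₀`, which take the strict transform to `1` (no single partial is a unit here);
* the smooth charts `isRegularRing_quotient_g₂/g₃` (`∂₀ = y₂`, a unit) and their radical ideals; `prime_g` (degree one in `y₀`, coefficient `y₁y₂` relatively
  prime to `y₁y₂ + y₁³ + y₂³`), `radical_span_g`.
-/

set_option linter.dupNamespace false -- mandated namespace `Summit.<Summit>.<Problem>` of this single-conjunct summit

noncomputable section

open MvPolynomial
open Literature.AlgebraicGeometry.Resolution

namespace Summit.ResolutionOfSingularities.ResolutionOfSingularities.Cruxes.EquisingularLiftNat.Sections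

namespace NodalCone

variable (k : Type) [Field k]

/-! ## The chart equations and their strict transforms -/

/-- `g = (y₀ + 1)y₁y₂ + y₁³ + y₂³`: the charts `D₊(x₀)` (`y = (x₁, x₂, x₃)`) and `D₊(x₁)` (`y = (x₀, x₂, x₃)`) alike. [folklore] -/
def g : MvPolynomial (Fin 3) k := (X 0 + 1) * X 1 * X 2 + X 1 ^ 3 + X 2 ^ 3

/-- `g₂ = (y₀ + y₁)y₂ + 1 + y₂³`: the chart `D₊(x₂)` (`y = (x₀, x₁, x₃)`), off the double line. [folklore] -/
def g₂ : MvPolynomial (Fin 3) k := (X 0 + X 1) * X 2 + 1 + X 2 ^ 3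

/-- `g₃ = (y₀ + y₁)y₂ + y₂³ + 1`: the chart `D₊(x₃)` (`y = (x₀, x₁, x₂)`), off the double line. [folklore] -/
def g₃ : MvPolynomial (Fin 3) k := (X 0 + X 1) * X 2 + X 2 ^ 3 + 1

/-- The strict transform `(y₀ + 1)y₂ + y₁ + y₁y₂³` of `g` on the chart `b = y₁` (`y₂ ↦ y₁y₂`). [folklore] -/
def g' : MvPolynomial (Fin 3) k := (X 0 + 1) * X 2 + X 1 + X 1 * X 2 ^ 3

/-- The strict transform `(y₀ + 1)y₁ + y₂y₁³ + y₂` of `g` on the chart `b = y₂` (`y₁ ↦ y₂y₁`). [folklore] -/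
def g'' : MvPolynomial (Fin 3) k := (X 0 + 1) * X 1 + X 2 * X 1 ^ 3 + X 2

/-! ## The two strict-transform charts of the double line (each serves `D₊(x₀)` and `D₊(x₁)`) -/

/-- **Chart `b = y₁`**: `g ↦ y₁²·((y₀+1)y₂ + y₁ + y₁y₂³)`; the combination derivation `D = ∂₁ − y₂²·∂₀` takes the strict transform to `(1 + y₂³) − y₂³ = 1`. [folklore] -/
theorem isRegularRing_chart₁ :
    IsRegularRing (blowupAlgebra ((Ideal.span (X '' CuspCone.cenVars)).map (Ideal.Quotient.mk (Ideal.span {g k})))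
      (Ideal.Quotient.mk (Ideal.span {g k}) (X 1 : MvPolynomial (Fin 3) k))) := by
  obtain ⟨h0, h1, h2⟩ := CuspCone.subst₁_X k
  refine CuspCone.isRegularRing_strictTransformChart k (g k) (g' k) 1 2 ?_ ?_ ?_
  · simp only [g, g', map_add, map_mul, map_pow, map_one, h0, h1, h2]
    ring
  · rintro ⟨q, hq⟩
    have h := congrArg (MvPolynomial.eval ![(0 : k), 0, 1]) hq
    simp [g'] at h
  · refine isRegularRing_quotient_of_derivation (g' k)
      (pderiv 1 - (X 2 ^ 2 : MvPolynomial (Fin 3) k) • pderiv 0 : Derivation k (MvPolynomial (Fin 3) k) (MvPolynomial (Fin 3) k)) ?_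
    have h : (pderiv 1 - (X 2 ^ 2 : MvPolynomial (Fin 3) k) • pderiv 0 :
        Derivation k (MvPolynomial (Fin 3) k) (MvPolynomial (Fin 3) k)) (g' k) = 1 := by
      simp [g', Derivation.leibniz_pow, pderiv_X]
      ring
    rw [h, map_one]
    exact isUnit_one

/-- **Chart `b = y₂`**: `g ↦ y₂²·((y₀+1)y₁ + y₂y₁³ + y₂)`; `D = ∂₂ − y₁²·∂₀` takes the strict transform to `1`. [folklore] -/
theorem isRegularRing_chart₂ :
    IsRegularRing (blowupAlgebra ((Ideal.span (X '' CuspCone.cenVars)).map (Ideal.Quotient.mk (Ideal.span {g k})))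
      (Ideal.Quotient.mk (Ideal.span {g k}) (X 2 : MvPolynomial (Fin 3) k))) := by
  obtain ⟨h0, h1, h2⟩ := CuspCone.subst₂_X k
  refine CuspCone.isRegularRing_strictTransformChart k (g k) (g'' k) 2 2 ?_ ?_ ?_
  · simp only [g, g'', map_add, map_mul, map_pow, map_one, h0, h1, h2]
    ring
  · rintro ⟨q, hq⟩
    have h := congrArg (MvPolynomial.eval ![(0 : k), 1, 0]) hq
    simp [g''] at h
  · refine isRegularRing_quotient_of_derivation (g'' k)
      (pderiv 2 - (X 1 ^ 2 : MvPolynomial (Fin 3) k) • pderiv 0 : Derivation k (MvPolynomial (Fin 3) k) (MvPolynomial (Fin 3) k)) ?_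
    have h : (pderiv 2 - (X 1 ^ 2 : MvPolynomial (Fin 3) k) • pderiv 0 :
        Derivation k (MvPolynomial (Fin 3) k) (MvPolynomial (Fin 3) k)) (g'' k) = 1 := by
      simp [g'', Derivation.leibniz_pow, pderiv_X]
      ring
    rw [h, map_one]
    exact isUnit_one

/-! ## The two charts off the double line -/

/-- **Chart `c = 2`**: `k[y]/(g₂)`, `g₂ = (y₀ + y₁)y₂ + 1 + y₂³`, is regular (`∂₀ g₂ = y₂`, a unit: `y₂·(−(y₀+y₁) − y₂²) ≡ 1`). [folklore] -/
theorem isRegularRing_quotient_g₂ : IsRegularRing (MvPolynomial (Fin 3) k ⧸ Ideal.span {g₂ k}) := by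
  refine isRegularRing_quotient_of_derivation (g₂ k)
    (pderiv 0 : Derivation k (MvPolynomial (Fin 3) k) (MvPolynomial (Fin 3) k)) ?_
  have h : (pderiv 0 : Derivation k (MvPolynomial (Fin 3) k) (MvPolynomial (Fin 3) k)) (g₂ k) = X 2 := by
    simp [g₂, pderiv_X, Derivation.leibniz_pow]
  rw [h]
  refine WhitneyCubic.isUnit_of_mul_eq_one' (Ideal.Quotient.mk _ (-(X 0 + X 1) - X 2 ^ 2)) ?_
  rw [← map_mul, ← (Ideal.Quotient.mk _).map_one, Ideal.Quotient.eq]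
  exact Ideal.mem_span_singleton.mpr ⟨-1, by rw [g₂]; ring⟩

/-- **Chart `c = 3`**: `k[y]/(g₃)`, `g₃ = (y₀ + y₁)y₂ + y₂³ + 1`, is regular (same unit). [folklore] -/
theorem isRegularRing_quotient_g₃ : IsRegularRing (MvPolynomial (Fin 3) k ⧸ Ideal.span {g₃ k}) := by
  refine isRegularRing_quotient_of_derivation (g₃ k)
    (pderiv 0 : Derivation k (MvPolynomial (Fin 3) k) (MvPolynomial (Fin 3) k)) ?_
  have h : (pderiv 0 : Derivation k (MvPolynomial (Fin 3) k) (MvPolynomial (Fin 3) k)) (g₃ k) = X 2 := by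
    simp [g₃, pderiv_X, Derivation.leibniz_pow]
  rw [h]
  refine WhitneyCubic.isUnit_of_mul_eq_one' (Ideal.Quotient.mk _ (-(X 0 + X 1) - X 2 ^ 2)) ?_
  rw [← map_mul, ← (Ideal.Quotient.mk _).map_one, Ideal.Quotient.eq]
  exact Ideal.mem_span_singleton.mpr ⟨-1, by rw [g₃]; ring⟩

/-- `(g₂)` is a radical ideal. [folklore] -/
theorem radical_span_g₂ : (Ideal.span {g₂ k}).radical = Ideal.span {g₂ k} := by
  haveI := isRegularRing_quotient_g₂ k
  haveI := IsRegularRing.isReduced' (MvPolynomial (Fin 3) k ⧸ Ideal.span {g₂ k})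
  exact (Ideal.isRadical_iff_quotient_reduced _).mpr inferInstance |>.radical

/-- `(g₃)` is a radical ideal. [folklore] -/
theorem radical_span_g₃ : (Ideal.span {g₃ k}).radical = Ideal.span {g₃ k} := by
  haveI := isRegularRing_quotient_g₃ k
  haveI := IsRegularRing.isReduced' (MvPolynomial (Fin 3) k ⧸ Ideal.span {g₃ k})
  exact (Ideal.isRadical_iff_quotient_reduced _).mpr inferInstance |>.radical

/-! ## `g` is prime -/

/-- `y₀y₁` and `y₀y₁ + y₀³ + y₁³` (in `k[y₀, y₁]`) are relatively prime (`y₀ ∤ y₁³`, `y₁ ∤ y₀³`). [folklore] -/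
theorem isRelPrime_coeff : IsRelPrime (X 0 * X 1 : MvPolynomial (Fin 2) k) (X 0 * X 1 + X 0 ^ 3 + X 1 ^ 3) := by
  have hp0 : Prime (X 0 : MvPolynomial (Fin 2) k) := X_prime
  have hp1 : Prime (X 1 : MvPolynomial (Fin 2) k) := X_prime
  have h0 : ¬ ((X 0 : MvPolynomial (Fin 2) k) ∣ X 0 * X 1 + X 0 ^ 3 + X 1 ^ 3) := by
    intro h
    have hd : (X 0 : MvPolynomial (Fin 2) k) ∣ X 0 * X 1 + X 0 ^ 3 :=
      dvd_add (dvd_mul_right (X 0) (X 1)) (dvd_pow_self (X 0) three_ne_zero)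
    have h' : (X 0 : MvPolynomial (Fin 2) k) ∣ X 1 ^ 3 := (dvd_add_right hd).mp h
    exact absurd (X_dvd_X.mp (hp0.dvd_of_dvd_pow h')) (by decide)
  have h1 : ¬ ((X 1 : MvPolynomial (Fin 2) k) ∣ X 0 * X 1 + X 0 ^ 3 + X 1 ^ 3) := by
    intro h
    have h' : (X 1 : MvPolynomial (Fin 2) k) ∣ X 0 * X 1 + X 0 ^ 3 := (dvd_add_left (dvd_pow_self (X 1) three_ne_zero)).mp h
    have h'' : (X 1 : MvPolynomial (Fin 2) k) ∣ X 0 ^ 3 := (dvd_add_right (dvd_mul_left (X 1) (X 0))).mp h'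
    exact absurd (X_dvd_X.mp (hp1.dvd_of_dvd_pow h'')) (by decide)
  exact (CayleyRuled.isRelPrime_of_prime_of_not_dvd hp0 h0).mul_left (CayleyRuled.isRelPrime_of_prime_of_not_dvd hp1 h1)

/-- **`g = (y₀ + 1)y₁y₂ + y₁³ + y₂³` is prime** (degree one in `y₀`: `C(y₁y₂)·Y + C(y₁y₂ + y₁³ + y₂³)`). [folklore] -/
theorem prime_g : Prime (g k) := by
  have hfin : finSuccEquiv k 2 (g k) = Polynomial.C (X 0 * X 1) * Polynomial.X + Polynomial.C (X 0 * X 1 + X 0 ^ 3 + X 1 ^ 3) := by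
    have h1 : finSuccEquiv k 2 (X 1) = Polynomial.C (X 0) := finSuccEquiv_X_succ (j := 0)
    have h2 : finSuccEquiv k 2 (X 2) = Polynomial.C (X 1) := finSuccEquiv_X_succ (j := 1)
    simp only [g, map_add, map_mul, map_pow, map_one, finSuccEquiv_X_zero, h1, h2]
    ring
  have hirr : Irreducible (g k) := by
    rw [← MulEquiv.irreducible_iff (finSuccEquiv k 2), hfin]
    exact Polynomial.irreducible_C_mul_X_add_C (mul_ne_zero (X_ne_zero 0) (X_ne_zero 1)) (isRelPrime_coeff k)
  exact UniqueFactorizationMonoid.irreducible_iff_prime.mp hirr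

/-- `(g)` is a radical ideal. [folklore] -/
theorem radical_span_g : (Ideal.span {g k}).radical = Ideal.span {g k} :=
  ((Ideal.span_singleton_prime (prime_g k).ne_zero).mpr (prime_g k)).radical

end NodalCone

end Summit.ResolutionOfSingularities.ResolutionOfSingularities.Cruxes.EquisingularLiftNat.Sections

end
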